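import Summits.HodgeConjecture.HodgeConjecture.Theorems.F0P6aPELInputs
import Summits.HodgeConjecture.HodgeConjecture.Theorems.F0P6aEReadings
import Literature.FieldTheory.AlgClosed.AdicCompletionAlgClosureEquivComplex
import Literature.FieldTheory.AlgClosed.AutomorphismExtension
import Literature.AlgebraicGeometry.AbelianSchemes.RoofBaseChangeAlongBaseIso
import Literature.AlgebraicGeometry.Motives.GaloisThickeningLiftAlongFieldHom
import Literature.NumberTheory.Automorphic.UnitaryGroupHeckeDegreeSplitPlace
import Literature.AlgebraicGeometry.ModuliOfAbelianVarieties.SiegelAdelicMarkingHoms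
import Literature.AlgebraicGeometry.ModuliOfAbelianVarieties.SiegelAdelicMarkingIsogenyQuotient
import Literature.AlgebraicGeometry.ModuliOfAbelianVarieties.SiegelAdelicMarkingRatRepUnique
import Literature.AlgebraicGeometry.ModuliOfAbelianVarieties.SiegelAdelicMarkingUnitFrameTorsionReading
import Summits.HodgeConjecture.HodgeConjecture.Theorems.F0P6aChartFramePin
import Literature.AlgebraicGeometry.ShimuraVarieties.UnitaryCurveAuxiliaryIntegralActionFamilyV
import Literature.AlgebraicGeometry.ShimuraVarieties.UnitaryCurveSiegelChartMoverOfClass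
import Literature.AlgebraicGeometry.AbelianSchemes.IsogenyRoofAlongPointBaseChangeOfEq
import Literature.AlgebraicGeometry.ModuliOfAbelianVarieties.HeckeCentralRoofOfMarkedPair
import Literature.AlgebraicGeometry.ShimuraVarieties.UnitaryCurveAuxiliaryHeckeTransporter
import Literature.AlgebraicGeometry.ShimuraVarieties.UnitaryCurveAuxiliaryFrameTwistOfFrame
import Literature.AlgebraicGeometry.ShimuraVarieties.UnitaryCurveAuxiliaryHeckeCentralLattice
import Literature.AlgebraicGeometry.ModuliOfAbelianVarieties.HeckeLineRoofsOfMarkedPair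
import Literature.AlgebraicGeometry.ShimuraVarieties.UnitaryCurveAuxiliaryHeckeLineLattices
import Literature.AlgebraicGeometry.ModuliOfAbelianVarieties.SiegelAdelicMarkingStableLines
import HarnessLib
import HarnessLib.Audit.LibrarySuggestionsDenyListCruxes

/-!
# `F0P6aStubEHECKE` — ★ VERBATIM TWIN (K6 P∕E column wave E2, LEAD F0P6-plan «M-142a» (B); RE-HOME TABLE v1.7 (LA7-plan (g7)), canonical header «M-142a» (A), carrier «M-142d» «P-κ») of the X-leaf `Lines/F0_P6a_StubEHECKE.lean`

**SIZE-LINT SPLIT ×6** (`Theorems/` files with proofs are ≤ 400 lines): parts `Theorems/F0P6aStubEHECKESocket.lean` → `Theorems/F0P6aStubEHECKEReaders.lean` → `Theorems/F0P6aStubEHECKEOrganT.lean` → `Theorems/F0P6aStubEHECKEOrganMP.lean` → `Theorems/F0P6aStubEHECKEStageB.lean` → `Theorems/F0P6aStubEHECKE.lean`, each importing the previous, cut at declaration boundaries of `Lines/F0_P6a_StubEHECKE.lean`; namespaces AND sections KEPT and re-opened per part (with their `open`∕`variable` lines replayed verbatim); the options preamble is repeated. This is PART 1.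

This `Theorems/` module is the TREE BYTES of `Summits/HodgeConjecture/HodgeConjecture/Cruxes/HLiu418/Lines/F0_P6a_StubEHECKE.lean` (tree sha16 aad6a91c0b7e0891, 1687 l.; sorry-free, stub-free = class B of RE-HOME TABLE v1.7)
re-homed VERBATIM with the NAMESPACE KEPT (`Summit.HodgeConjecture.HodgeConjecture.Cruxes.HLiu418.F0P6aStubEHECKE`), so every fully-qualified name of its 47 declarations is UNCHANGED
(0 FQN moves, 0 downstream bytes, 0 statement bytes).  The only edits are (a) this re-headed module docstring, (b) the `Lines` imports switched to their ★ homes (l.1 `Lines.F0_P6a_PELInputs` → `Theorems.F0P6aPELInputs`; l.2 `Lines.F0_P6a_EReadings` → `Theorems.F0P6aEReadings`; l.12 `Lines.F0_P6a_ChartFramePin` → `Theorems.F0P6aChartFramePin`),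
and (c) on the docstrings of the header-CLOSED `def … : Prop` letters (`StubEHECKE`, `OrganET`, `OrganMP`, `OrganEC`, `OrganER1`, `OrganER2`) the locator tokens are spelled `(print: …)` instead of `[cite: …]` — same locators, same prose — because a `[cite:]`-tagged closed Prop in a `Theorems/` proposal is
RELOCATED to `Literature/` by the gate («STATE IT INLINE» rule; observed p852785∕p852786, LA-ref1 (g5) BOX K5 #R1), which would MOVE the FQN; these Props are statement
ABBREVIATIONS of our own sockets, not printed facts (precedent ★ `Theorems/F0P6aModuliDatumDefs.lean` `RecordModuliDatumCofinal` `(print:)` ×5).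

Why: E-column parents-first — this leaf imports the P-LINE (★ K5 №5), the E-READINGS (★ wave E1) and the frame pin (★ since K3) and is imported by `F0_P6a_EExports` →
`F0_P6a_StubGEN` → `F0_P6a_PELSpread` hub → MAIN; a `Theorems/` file cannot import a `Lines/` workfile (gate import fence), so it is re-homed before them.  After its LAST
part is ★ the `Lines` original becomes the next edition = SHIM (`import` of this module + `HarnessLib` + carrier; 0 declarations) in a K6 shim wave on the LEAD՚s cue.
HC_CM is proved only modulo the 7 printed citations (2 remaining: hLiu418 = stmt-HodgeConjecture-24832, h413 = stmt-HodgeConjecture-24833) until rung 0 closes; a re-home is count-neutral.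

## Import provenance (header is CANONICAL: bare `import` lines, «M-142a» (A); the ROOT part carries `HarnessLib.Audit.LibrarySuggestionsDenyListCruxes`, «M-142d» «P-κ»)
- `Summits.HodgeConjecture.HodgeConjecture.Theorems.F0P6aPELInputs` — ★ K5 №5 p852908 (№3 `…PELInputsSpread` p852878 → №4 `…PELInputsRows` p852892 ride): the P-LINE twin; the `Lines` module is its ED. 5 shim since 23:12Z (commit ac4e71d58f4d)
- `Summits.HodgeConjecture.HodgeConjecture.Theorems.F0P6aEReadings` — ★ K6 E1 twin of `Lines/F0_P6a_EReadings.lean` ED. 2 18b1390e9a57b55f (LAST part; `…EReadingsDefs` → `…EReadingsHecke` ride)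
- `Literature.FieldTheory.AlgClosed.AdicCompletionAlgClosureEquivComplex` — ★ p849445 `exists_ringEquiv_algebraicClosure_adicCompletion_complex_comp_eq` (σ : F̄_w ≃+* ℂ over ι₁)
- `Literature.FieldTheory.AlgClosed.AutomorphismExtension` — ★ `exists_ringEquiv_apply_eq` (prescribe σ on the countable `Fᵢ`)
- `Literature.AlgebraicGeometry.AbelianSchemes.RoofBaseChangeAlongBaseIso` — ★ p849519 `roof_baseChange_of_isIso` (+ ★ `IsogenyRoofTransportAlongIso`, transfers of points)
- `Literature.AlgebraicGeometry.Motives.GaloisThickeningLiftAlongFieldHom` — ★ `thickeningLift_left_eq_comp_of_left_eq` (sheet points move along `σ`)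
- `Literature.NumberTheory.Automorphic.UnitaryGroupHeckeDegreeSplitPlace` — ★ `natCard_orbit_heckeElementAt_one_uniformizer` (= q+1), `orbit_heckeElementAt_self_eq_singleton`, `card_submodule_codim_one_of_finrank_eq_two`
- `Literature.AlgebraicGeometry.ModuliOfAbelianVarieties.SiegelAdelicMarkingHoms` — ★ `exists_hom_forall_map_r_eq_of_forall_mem`, `hom_eq_of_forall_map_r_eq`
- `Literature.AlgebraicGeometry.ModuliOfAbelianVarieties.SiegelAdelicMarkingIsogenyQuotient` — ★ `surjective_map_of_forall_map_r_eq`, `exists_r_eq_of_isIsogeny_of_map_eq_one`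
- `Literature.AlgebraicGeometry.ModuliOfAbelianVarieties.SiegelAdelicMarkingRatRepUnique` — ★ p850115 (LA6-p02 (g2)) `map_intCast_mul_eq_mul_map_intCast_of_forall_map_r_eq` ((MP-J) of (O-MP) STAGE A)
- `Literature.AlgebraicGeometry.ModuliOfAbelianVarieties.SiegelAdelicMarkingUnitFrameTorsionReading` — ★ `SiegelAdelicMarking.map_r_eq_of_map_toFun_mapMatrix` (torus reading ⇒ torsion reading)
- `Summits.HodgeConjecture.HodgeConjecture.Theorems.F0P6aChartFramePin` — ★ p850217 (the `Lines` module is its ED. 2 shim since K3): the frame pin `IsChartOfFrame`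
- `Literature.AlgebraicGeometry.ShimuraVarieties.UnitaryCurveAuxiliaryIntegralActionFamilyV` — ★ p849552 (LA5-p01 (g3)): frame vocabulary `SymplecticFrameV`, `auxToGspFinV`, `framePV`… for the cand-v3 FRAME PIN
- `Literature.AlgebraicGeometry.ShimuraVarieties.UnitaryCurveSiegelChartMoverOfClass` — ★ `exists_mover_of_mk_eq_mk_frame` (the (O-M) junction: two calls, A-p01 (g28) 05:42:18Z)
- `Literature.AlgebraicGeometry.AbelianSchemes.IsogenyRoofAlongPointBaseChangeOfEq` — ★ p850116 (B-p08 (g34)) (O-T.1)–(O-T.4) `roof_readAt_comp_of_eq`, `exists_pointsAlong_mulEquiv_of_eq`, `pointsAlong_*_of_eq` (+ by import ★ p849602)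
- `Literature.AlgebraicGeometry.ModuliOfAbelianVarieties.HeckeCentralRoofOfMarkedPair` — ★ p850307 (A-p06 (g35)) `exists_heckeCentralRoof_of_markedReadings` — the (O-R2) generic central roof (L5-#7 junction, LA5-p01 (g4))
- `Literature.AlgebraicGeometry.ShimuraVarieties.UnitaryCurveAuxiliaryHeckeTransporter` — ★ p850154∕p850257∕p850267∕p850301 (T-Λ)(T-ν)(T-lvl)(T-Λ♭)(T-Λc transport) — (O-MP) STAGE B (B-p08 (g35))
- `Literature.AlgebraicGeometry.ShimuraVarieties.UnitaryCurveAuxiliaryFrameTwistOfFrame` — ★ p850335 `exists_twist_of_frame` (twist data OF the pinned frame) — (O-MP) STAGE B (B-p08 (g35))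
- `Literature.AlgebraicGeometry.ShimuraVarieties.UnitaryCurveAuxiliaryHeckeCentralLattice` — ★ p850382 (LA5-p02 (g4)) `forall_reading_mulVec_mem_latticeOfGL_heckeCentral_iff` (the central frame law, (T-Λc) `hframe`)
- `Literature.AlgebraicGeometry.ModuliOfAbelianVarieties.HeckeLineRoofsOfMarkedPair` — ★ p850332 (A-p13 (g39)) `exists_heckeLineRoof_of_markedReadings` — the (O-R1) generic LINE roof (L5-#8′)
- `Literature.AlgebraicGeometry.ShimuraVarieties.UnitaryCurveAuxiliaryHeckeLineLattices` — ★ p850395 (A-p13 (g39)) `exists_heckeLineLattices` — the (O-R1) line lattices in reading currency (L5-#8′)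
- `Literature.AlgebraicGeometry.ModuliOfAbelianVarieties.SiegelAdelicMarkingStableLines` — ★ p849958∕p850000 (LA5-p01 (g3)) `exists_stableLines` (R1-α) — conjuncts (1)(2)(3) of (O-R1)
- `HarnessLib`
- (non-import header line of the workfile, dropped from the canonical header, kept here verbatim:) `-- import Literature.AlgebraicGeometry.ModuliOfAbelianVarieties.SiegelAdelicMarkingHomKernel            -- ★ p849613 (LA5-p02 (g3), DEAL L5-#1): kernel ∕ image ∕ card laws of marked homs — RE-ENABLED in v2 once its olean is served (farm «unbuilt» 05:58Z)`

## Original module docstring (verbatim)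
# `Lines/F0_P6a_StubEHECKE.lean` (skeleton v10 — SORRY-FREE: v7 + (O-R2) PAID by LA5-p01 (g4) + (O-MP-α) STAGE B PAID by B-p08 (g35) + (O-R1) PAID by A-p13 (g39)) — THE EHECKE CLOSER LEAF: `stub_EHECKE_of_line : StubEHECKE` (= X-leaf `RecordEHeckeReading` VERBATIM)

**(O-R2) PAID EDITION (LA5-p01 (g4), L5-#7, on v7 b12a2e9c4f30d997):** `stub_ER2`'s `sorry` is REPLACED by `stub_ER2_of_MP stub_MP` (§2, `theorem stub_ER2_of_MP : OrganMP → OrganER2`,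
kernel-checked, axioms TRIO) and ONE import is added (★ p850307 `HeckeCentralRoofOfMarkedPair`); every other byte of v7 is unchanged.  Expected sorries EXACTLY 2 = {`stub_MP`, `stub_ER1`}.

Cell `hodgecm-mathlib` (D-0151), P6 «MOD programme», crux hLiu418 = `stmt-HodgeConjecture-24832`, sub-line P6a, line «L5»; pen LA5-plan (g3) (A-p01 (g28) 05:39:28Z (N1):
«the socket stays BY VALUE; (O-M)(O-L)(O-H) are organs BELOW it, assembled by an EHECKE CLOSER LEAF `Lines/F0_P6a_StubEHECKE.lean` (imports E-READINGS + L6 + (D) + the ★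
organs, NOT the X-leaf); head `stub_EHECKE_of_line : ‹RecordEHeckeReading VERBATIM›`; X-leaf ED. 2 sets `stub_EHECKE := F0P6aStubEHECKE.stub_EHECKE_of_line`, the L6 pattern»).
The X-LEAF `Lines/F0_P6a_EExports.lean` (cand v1 9bd9c5d5) socket `stub_EHECKE : RecordEHeckeReading` is (H-E): «at a good split hyperspecial place `w`, both Hecke operators
act on the canonical pull-back `P = C.𝓜.univ ×_{𝓜.M} X` by the isogeny roofs `RoofE` through the `𝒪_F`-stable order-`p^f` subgroups of the `𝔭_{c•w}`-torsion, at every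
`F̄_w`-point of every sheet `e′`» (E-READINGS ED. 3 `HeckeRoofsE` :221).

STRUCTURE.  §0 `StubEHECKE` = the letter BY COPY (token for token).  §1 GENERIC-`Ω` READERS `schAt`∕`fibreAt`∕`dualAt`∕`polAt`∕`lvlPtAt`∕`actAt`∕`IsIdealTorsionAt`∕`RoofAt`∕
`HeckeRoofsAt` = the E-READINGS ED. 3 bodies :60–:287 TOKEN FOR TOKEN with `F̄_w ↦ Ω` and the `∀ e′ N′ hN′Kc rc₁ _ hrcN₁ rc₂ _ hrcN₂ x′` binders of `HeckeRoofsE` turned into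
ARGUMENTS, so that (i) `HeckeRoofsE S … ← ∀ e′ N′ …, HeckeRoofsAt … e′ N′ … x′` by unfolding (`heckeRoofsE_of_forall_heckeRoofsAt`) and (ii) the SAME reading is statable at
COMPLEX points (`Ω := ℂ` as an `F`-algebra through `ι₁`, sheet `τE♯ : Fi →ₐ[F] ℂ`).  §2 THE TWO ORGANS of this edition: `stub_EC : OrganEC` — «THE COMPLEX SIDE»: the
letter՚s hypotheses through `RingActionReading C ε ρ` and the (U4-w) guards give `HeckeRoofsAt … τE♯ … x′_ℂ` at EVERY complex point `x′_ℂ` of `X_{N′}` (the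
complex-uniformisation content: L6 `Reads` markings, ★ `exists_mover_of_mk_eq_mk_frame` junction ×2, ★ `S.IsHeckeTranslate`, the lattice law (O-L) (LA5-p01 (g3)), the
marked-hom kernel laws (O-H) ★ p849613 (LA5-p02 (g3)), the Serre-tensor roof middle (O-B), the ★ count `q+1`; skeleton v2 SPLITS it into those organs with
`stub_EC_of_organs` PROVED), and `stub_ET : OrganET` — «TRANSPORT»: the Hecke roofs read at the complex point `σ_* x′` on the sheet `τE♯` move to the `F̄_w`-point `x′`
on the sheet `e′` for any ring isomorphism `σ : F̄_w ≃+* ℂ` with `σ ∘ e′ = τE` (★ `thickeningLift_mk_specMap_comp_left`, ★ `tupleRel_baseChangeCompGrpIso_inv`, ★ p849519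
`pointsTransfer_*`∕`roof_baseChange_of_isIso`, ★ p849602, ★ `HeckeLines.lines_transport`; offered BY NAME to B-p08 (g34), L5-#5).  §3 THE HEAD `stub_EHECKE_of_line` PROVED
from the two organs: the `Fᵢ`-PINNED `σ` exists by ★ p849445 `exists_ringEquiv_algebraicClosure_adicCompletion_complex_comp_eq` followed by ★
`Literature.FieldTheory.AlgClosed.exists_ringEquiv_apply_eq` on the countable field `Fᵢ` (no sheet law is used: EVERY sheet `e′` is carried onto the `τE`-sheet).

THE CUT BELOW `stub_EC` (LA5-plan census 05:36Z, A-p01 «=» 05:39:28Z).  The roof middle is FORCED by (r2): `B ≅ A_{y″} ⊗ 𝔭_w⁻¹`, analytically `V_ℝ∕𝔭_w⁻¹Λ_{a·rcβ}`,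
NOT a `GSp_δ`-lattice torus, so `B` carries no `SiegelAdelicMarking`; the analytic side supplies the `𝔭_w`-FAMILY OF MARKED HOMS `h_π : A_y ⟶ A_{y″}` (`π ∈ 𝔭_w`, rational
matrices `q_π := q_s⁻¹ ρ₀(π) q_r` in the movers՚ frame, integral by (L-a)), the Serre-tensor side the roof `A_y —q→ A_{y″} ⊗ 𝔭_w⁻¹ ←c— A_{y″}` with
`ker q = {P | ∀ π ∈ 𝔭_w, h_π P = 1}`, and `H_β = ker q ∩ A_y[𝔭_{c•w}]` is a LINE of order `q = p^f`, injective in `β`, exhaustive by COUNTING (`#(Kc t₁ Kc ∕ Kc) = q+1 =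
#`lines, ★ `natCard_orbit_heckeElementAt_one_uniformizer` + ★ `card_submodule_codim_one_of_finrank_eq_two`).
REPORT-FIRST (HOME-only until LEAD heir F0P6-plan (g3) words the `crux write`): `lean check --json` rc 0 with sorries = the organ stubs ONLY; `--axioms stub_EHECKE_of_line` =
TRIO ∪ {sorryAx}.  Count-neutral Lines capital; no `Theorems/` file imports it.
HONEST LABEL: HC_CM is proved only modulo the 7 printed citations (2 remaining named inputs: hLiu418 = stmt-HodgeConjecture-24832, h413 = stmt-HodgeConjecture-24833)
until rung 0 closes; this leaf asserts nothing beyond its sorried organ stubs.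
[cite: Liu2021, Lemma C.18 p. 115, Prop. D.8 p. 135] [cite: Kottwitz1992, §5 pp. 389–391] [cite: RapoportSmithlingZhang2020Diagonal, §4.1 p. 17, §4.3 (4.23) p. 21]
[cite: HarrisTaylorAMS2001, §III.4, pp. 108–110] [cite: MumfordAV1970, §23 Thm. 2 p. 231] [cite: Lang2002, Ch. VIII §1 and Ch. V §2 Thm. 2.8]
[cite: GortzWedhorn2020, Section (4.8)–(4.9)] [cite: MumfordFogartyKirwan1994, Ch. 6 §1 (p. 115)]
-/

set_option autoImplicit false

noncomputable section


namespace Summit.HodgeConjecture.HodgeConjecture.Cruxes.HLiu418.F0P6aStubEHECKE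

set_option linter.dupNamespace false

open CategoryTheory CategoryTheory.Limits NumberField IsDedekindDomain MulAction AlgebraicGeometry
open scoped Matrix Polynomial Pointwise
open Literature.NumberTheory.GaloisRepresentations
open Literature.NumberTheory.Automorphic Literature.NumberTheory.Automorphic.UnitaryGroup
open Literature.AlgebraicGeometry.ShimuraVarieties Literature.AlgebraicGeometry.ShimuraVarieties.UnitaryCanonicalModel
open Literature.NumberTheory.Automorphic.Liu2021.AppendixC
open Literature.AlgebraicGeometry.Motives (AlgPoints ComplexPoints SchemeOver thickeningLift specOver)
open Literature.AlgebraicGeometry.Motives.AbelianVariety (bcSpec)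
open Literature.AlgebraicGeometry.AbelianSchemes (PolarizedAbelianSchemeWithLevel AbelianSchemeOver)
open Literature.AlgebraicGeometry.ModuliOfAbelianVarieties
open Summit.HodgeConjecture.HodgeConjecture.Cruxes.HLiu418.F0P6aPELWitnessE
open Summit.HodgeConjecture.HodgeConjecture.Cruxes.HLiu418.F0P6aStubE6 (RingActionReading Reads)
open Summit.HodgeConjecture.HodgeConjecture.Cruxes.HLiu418.F0P6aEReadings (EHeckeAt HeckeRoofsE RoofE schEOf fibreEOf dualEOf polEOf lvlPtEOf actEOf IsIdealTorsionE)
open Literature.AlgebraicGeometry.AbelianSchemes.AbelianSchemeOver (fibreHom RingAction exists_pointsAlong_mulEquiv_of_eq pointsAlong_map_of_eq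
  pointsAlong_forall_map_eq_one_iff_of_eq roof_readAt_comp_of_eq)
open Summit.HodgeConjecture.HodgeConjecture.Cruxes.HLiu418.F0P6aModuliDatumDefs
open Summit.HodgeConjecture.HodgeConjecture.Cruxes.HLiu418.F0P6aRGDAssembly
open Literature.AlgebraicGeometry.Motives (CMType)
open Literature.AlgebraicGeometry.ShimuraVarieties.UnitaryCanonicalModel.Aux (ratBasis torusFinAdelic)
open Literature.AlgebraicGeometry.ShimuraVarieties.UnitaryCurve Literature.AlgebraicGeometry.ShimuraVarieties.UnitaryCurve.AuxV
open Literature.NumberTheory.ComplexMultiplication.CMTypeOps (flip bar)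
open Literature.Geometry.Kaehler (ComplexTorus)
open Summit.HodgeConjecture.HodgeConjecture.Cruxes.HLiu418.F0P6aChartFramePin (IsChartOfFrame)

/-! ### §0 The socket letter BY COPY — `StubEHECKE` = X-leaf ED. 1 (tree 18446880) `RecordEHeckeReading` :105–:133, token for token; the pin `IsChartOfFrame` BY IMPORT of the shared pin module -/

-- §0 `IsChartOfFrame` := THE SHARED PIN MODULE `Lines/F0_P6a_ChartFramePin.lean` (A-p01 (g28) 9cb8837e, LEAD (P) «=» 06:31:22Z) — imported, same constant as the X-leaf socket.


set_option maxHeartbeats 400000 in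
/-- **`StubEHECKE`** — the X-leaf letter `F0P6aEExports.RecordEHeckeReading` (A-p01 (g28) cand v3 e3c1df28 :120–:147, FRAME-PINNED) TOKEN FOR TOKEN, so that X-leaf ED. 2 closes its
socket BY NAME: `theorem stub_EHECKE : RecordEHeckeReading := F0P6aStubEHECKE.stub_EHECKE_of_line` (the L6 pattern).  NOT asserted by declaring it. (print: Liu2021, Lemma C.18 p. 115, Prop. D.8 p. 135) (print: Kottwitz1992, §5 pp. 389–391) -/
def StubEHECKE : Prop :=
  ∀ (F : Type) [Field F] [NumberField F] [IsCMField F] [IsGalois ℚ F] (ι₁ : F →+* ℂ)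
    (Jstar : Matrix (Fin 2) (Fin 2) F) (hJ : (Jstar.map (IsCMField.complexConj F))ᵀ = Jstar) (hJu : IsUnit Jstar)
    (K₀ : C5.OpenCompactSubgroup (GSAdele F Jstar)) (S : RecordSystemGS F Jstar ι₁ K₀) (hU7ₛ : S.HeckeTranslateDefinedOver) (Kc : C5.SmallLevel K₀)
    (Fi : Type) [Field Fi] [NumberField Fi] [Algebra F Fi] [IsGalois F Fi] (τE : Fi →+* ℂ) (_hτE : τE.comp (algebraMap F Fi) = ι₁)
    (Φ : Set (F →+* ℂ)) (hΦ : IsCMTypeThrough ι₁ Φ) (C : AuxChartGS F ι₁ Jstar K₀ S Kc Fi τE Φ)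
    (ξ : F) (k : ℕ) (Fr : SymplecticFrameV F (RingHom.id F) Jstar ((k : ℚ) • ξ) C.g C.δ) (_hpin : IsChartOfFrame hΦ C ξ k Fr)
    (ε : (Literature.AlgebraicGeometry.Motives.baseChange F Fi).obj (S.M.obj Kc) ⟶
        (Literature.AlgebraicGeometry.Motives.baseChange ℚ Fi).obj C.𝓜.M)
    (_hε : letI : Algebra Fi ℂ := τE.toAlgebra
      ∀ (P : ComplexPoints ((Literature.AlgebraicGeometry.Motives.baseChange F Fi).obj (S.M.obj Kc)))
        (Pflat : letI : Algebra F ℂ := ι₁.toAlgebra; ComplexPoints (S.M.obj Kc)),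
        Pflat.left = P.left ≫ pullback.fst (S.M.obj Kc).hom (bcSpec F Fi) →
        (AlgPoints.map ε P).left ≫ pullback.fst C.𝓜.M.hom (bcSpec ℚ Fi) =
          (letI : Algebra F ℂ := ι₁.toAlgebra; (C.f (S.pts Kc Pflat)).left))
    (ρ : AbelianSchemeOver.RingAction (𝓞 F) (C.𝓜.univ.baseChange (ε.left ≫ pullback.fst C.𝓜.M.hom (bcSpec ℚ Fi))).A),
    RingActionReading C ε ρ →
    ∀ (w : HeightOneSpectrum (𝓞 F)) (hw : (IsCMField.complexConj F) • w ≠ w),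
      UnitaryGroup.IsHyperspecialAt ↥(maximalRealSubfield F) F (IsCMField.complexConj F) 2 Jstar Kc.1.1
          (w.under (𝓞 ↥(maximalRealSubfield F))) →
      (UnitaryGroup.isUnit_placeForm Jstar hJu w).unit ∈ glInt 2 (w.adicCompletion F) →
      ∀ (pChar fDeg : ℕ), Nat.Prime pChar → (pChar : 𝓞 F) ∈ w.asIdeal →
        Nat.card (𝓞 F ⧸ ((IsCMField.complexConj F) • w).asIdeal) = pChar ^ fDeg → ¬ pChar ∣ C.N →
        letI P := C.𝓜.univ.baseChange (ε.left ≫ pullback.fst C.𝓜.M.hom (bcSpec ℚ Fi))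
        HeckeRoofsE S hU7ₛ hJ hJu Kc w hw P.A ρ P.D P.pol P.level pChar fDeg


/-! ### §1 GENERIC-`Ω` READERS — E-READINGS ED. 3 :60–:287 bodies TOKEN FOR TOKEN with `F̄_w ↦ Ω` (any `F`-field `Ω`, sheet `e : Fi →ₐ[F] Ω`) -/

/-- (E-ii-3) the E-tuple՚s abelian SCHEME over `Spec Ω` at the sheet point `ℓ_e y` — ONE base change `𝒜 ×_X Spec Ω` along `thickeningLift e (S.M.obj Kc) y` (twin of Defs
`schΩOf`, whose iterated base change along `ι_η` then `ℓ_e y` it replaces); `fibreAt … 𝒜 y = (schAt … 𝒜 y).toAffine.toAbelianVariety` ON THE NOSE (★ `fibre`).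
[cite: MumfordFogartyKirwan1994, Ch. 6 §1 (p. 115)] -/
abbrev schAt {F : Type} [Field F] [NumberField F] [IsCMField F] {ι₁ : F →+* ℂ} {Jstar : Matrix (Fin 2) (Fin 2) F}
    {K₀ : C5.OpenCompactSubgroup ↥(finAdelic ↥(maximalRealSubfield F) F (IsCMField.complexConj F) 2 Jstar)}
    (S : RecordSystemGS F Jstar ι₁ K₀) {Fi : Type} [Field Fi] [Algebra F Fi] (Kc : C5.SmallLevel K₀)
    {Ω : Type} [Field Ω] [Algebra F Ω] (e : Fi →ₐ[F] Ω)
    (𝒜 : Literature.AlgebraicGeometry.AbelianSchemes.AbelianSchemeOver ((Literature.AlgebraicGeometry.Motives.baseChange F Fi).obj (S.M.obj Kc)).left)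
    (y : AlgPoints (S.M.obj Kc) Ω) :
    Literature.AlgebraicGeometry.AbelianSchemes.AbelianSchemeOver (AlgebraicGeometry.Spec (CommRingCat.of Ω)) :=
  𝒜.baseChange (thickeningLift e (S.M.obj Kc) y).left

/-- (E-ii-1) the abelian variety over `Ω = F̄_w` underlying the fibre of the E-tuple at the sheet point `ℓ_e y` (★ `fibre`; twin of Defs `fibreΩOf`; the (K-Ω) currency of the
E-line՚s `kottwitz` field read at `Ω`-points). [cite: MumfordFogartyKirwan1994, Ch. 6 §1 (p. 115)] -/
abbrev fibreAt {F : Type} [Field F] [NumberField F] [IsCMField F] {ι₁ : F →+* ℂ} {Jstar : Matrix (Fin 2) (Fin 2) F}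
    {K₀ : C5.OpenCompactSubgroup ↥(finAdelic ↥(maximalRealSubfield F) F (IsCMField.complexConj F) 2 Jstar)}
    (S : RecordSystemGS F Jstar ι₁ K₀) {Fi : Type} [Field Fi] [Algebra F Fi] (Kc : C5.SmallLevel K₀)
    {Ω : Type} [Field Ω] [Algebra F Ω] (e : Fi →ₐ[F] Ω)
    (𝒜 : Literature.AlgebraicGeometry.AbelianSchemes.AbelianSchemeOver ((Literature.AlgebraicGeometry.Motives.baseChange F Fi).obj (S.M.obj Kc)).left)
    (y : AlgPoints (S.M.obj Kc) Ω) :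
    Literature.AlgebraicGeometry.Motives.AbelianVariety Ω :=
  (𝒜.fibre (thickeningLift e (S.M.obj Kc) y).left).toAbelianVariety

/-- (E-ii-3) the dual pair `(Â, 𝒫)` of the E-tuple read at `ℓ_e y` (★ `DualPair.baseChange`, once; twin of Defs `dualΩOf`). [cite: MumfordFogartyKirwan1994, Ch. 6 §1 (p. 115)] -/
abbrev dualAt {F : Type} [Field F] [NumberField F] [IsCMField F] {ι₁ : F →+* ℂ} {Jstar : Matrix (Fin 2) (Fin 2) F}
    {K₀ : C5.OpenCompactSubgroup ↥(finAdelic ↥(maximalRealSubfield F) F (IsCMField.complexConj F) 2 Jstar)}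
    (S : RecordSystemGS F Jstar ι₁ K₀) {Fi : Type} [Field Fi] [Algebra F Fi] (Kc : C5.SmallLevel K₀)
    {Ω : Type} [Field Ω] [Algebra F Ω] (e : Fi →ₐ[F] Ω)
    (𝒜 : Literature.AlgebraicGeometry.AbelianSchemes.AbelianSchemeOver ((Literature.AlgebraicGeometry.Motives.baseChange F Fi).obj (S.M.obj Kc)).left)
    (D : 𝒜.DualPair) (y : AlgPoints (S.M.obj Kc) Ω) : (schAt S Kc e 𝒜 y).DualPair :=
  D.baseChange (thickeningLift e (S.M.obj Kc) y).left

/-- (E-ii-3) the polarisation `λ` of the E-tuple read at `ℓ_e y` (★ `Polarization.baseChange`, once; EXACT, no scalar; twin of Defs `polΩOf`).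
[cite: MumfordFogartyKirwan1994, Ch. 6 §2 Definition 6.3 (p. 120)] -/
abbrev polAt {F : Type} [Field F] [NumberField F] [IsCMField F] {ι₁ : F →+* ℂ} {Jstar : Matrix (Fin 2) (Fin 2) F}
    {K₀ : C5.OpenCompactSubgroup ↥(finAdelic ↥(maximalRealSubfield F) F (IsCMField.complexConj F) 2 Jstar)}
    (S : RecordSystemGS F Jstar ι₁ K₀) {Fi : Type} [Field Fi] [Algebra F Fi] (Kc : C5.SmallLevel K₀)
    {Ω : Type} [Field Ω] [Algebra F Ω] (e : Fi →ₐ[F] Ω)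
    (𝒜 : Literature.AlgebraicGeometry.AbelianSchemes.AbelianSchemeOver ((Literature.AlgebraicGeometry.Motives.baseChange F Fi).obj (S.M.obj Kc)).left)
    {D : 𝒜.DualPair} (pol : 𝒜.Polarization D) (y : AlgPoints (S.M.obj Kc) Ω) :
    (schAt S Kc e 𝒜 y).Polarization (dualAt S Kc e 𝒜 D y) :=
  pol.baseChange (thickeningLift e (S.M.obj Kc) y).left

/-- (E-ii-3) the level point `σ^a(ℓ_e y) ∈ A_{ℓ_e y}(Ω)` of a level-`N` structure on the E-tuple (★ `section_`, ★ `restrictPt`; twin of Defs `lvlPtΩOf`).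
[cite: MumfordFogartyKirwan1994, Ch. 7 §2 Definition 7.1 (p. 129)] -/
def lvlPtAt {F : Type} [Field F] [NumberField F] [IsCMField F] {ι₁ : F →+* ℂ} {Jstar : Matrix (Fin 2) (Fin 2) F}
    {K₀ : C5.OpenCompactSubgroup ↥(finAdelic ↥(maximalRealSubfield F) F (IsCMField.complexConj F) 2 Jstar)}
    (S : RecordSystemGS F Jstar ι₁ K₀) {Fi : Type} [Field Fi] [Algebra F Fi] (Kc : C5.SmallLevel K₀)
    {Ω : Type} [Field Ω] [Algebra F Ω] (e : Fi →ₐ[F] Ω)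
    (𝒜 : Literature.AlgebraicGeometry.AbelianSchemes.AbelianSchemeOver ((Literature.AlgebraicGeometry.Motives.baseChange F Fi).obj (S.M.obj Kc)).left)
    {g N : ℕ} (lvl : 𝒜.LevelStructure g N) (y : AlgPoints (S.M.obj Kc) Ω) (a : Fin g ⊕ Fin g → ZMod N) :
    (fibreAt S Kc e 𝒜 y).Points Ω :=
  𝒜.restrictPt (thickeningLift e (S.M.obj Kc) y).left (lvl.section_ a)

/-- (E-ii-1) the endomorphism `ι(a)` of the fibre of the E-tuple at `ℓ_e y` induced by a ring action `ρ` of `𝒪_F` (★ `fibreHom (ρ.i a)`; twin of Defs `actΩOf`; the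
E-line՚s `kottwitz`-field currency). [cite: Kottwitz1992, §5, p. 390] -/
def actAt {F : Type} [Field F] [NumberField F] [IsCMField F] {ι₁ : F →+* ℂ} {Jstar : Matrix (Fin 2) (Fin 2) F}
    {K₀ : C5.OpenCompactSubgroup ↥(finAdelic ↥(maximalRealSubfield F) F (IsCMField.complexConj F) 2 Jstar)}
    (S : RecordSystemGS F Jstar ι₁ K₀) {Fi : Type} [Field Fi] [Algebra F Fi] (Kc : C5.SmallLevel K₀)
    {Ω : Type} [Field Ω] [Algebra F Ω] (e : Fi →ₐ[F] Ω)
    (𝒜 : Literature.AlgebraicGeometry.AbelianSchemes.AbelianSchemeOver ((Literature.AlgebraicGeometry.Motives.baseChange F Fi).obj (S.M.obj Kc)).left)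
    (ρ : Literature.AlgebraicGeometry.AbelianSchemes.AbelianSchemeOver.RingAction (𝓞 F) 𝒜) (a : 𝓞 F)
    (y : AlgPoints (S.M.obj Kc) Ω) :
    fibreAt S Kc e 𝒜 y ⟶ fibreAt S Kc e 𝒜 y :=
  haveI := ρ.isMonHom a
  Literature.AlgebraicGeometry.AbelianSchemes.AbelianSchemeOver.fibreHom (ρ.i a) (thickeningLift e (S.M.obj Kc) y).left

/-- (E-ii-3) the `Ω`-point `P` of the fibre of the E-tuple at `ℓ_e y` is KILLED BY THE IDEAL `𝔞 ⊆ 𝒪_F` (twin of Defs `IsIdealTorsionΩ`). [cite: Kottwitz1992, §5, p. 390] -/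
def IsIdealTorsionAt {F : Type} [Field F] [NumberField F] [IsCMField F] {ι₁ : F →+* ℂ} {Jstar : Matrix (Fin 2) (Fin 2) F}
    {K₀ : C5.OpenCompactSubgroup ↥(finAdelic ↥(maximalRealSubfield F) F (IsCMField.complexConj F) 2 Jstar)}
    (S : RecordSystemGS F Jstar ι₁ K₀) {Fi : Type} [Field Fi] [Algebra F Fi] (Kc : C5.SmallLevel K₀)
    {Ω : Type} [Field Ω] [Algebra F Ω] (e : Fi →ₐ[F] Ω)
    (𝒜 : Literature.AlgebraicGeometry.AbelianSchemes.AbelianSchemeOver ((Literature.AlgebraicGeometry.Motives.baseChange F Fi).obj (S.M.obj Kc)).left)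
    (ρ : Literature.AlgebraicGeometry.AbelianSchemes.AbelianSchemeOver.RingAction (𝓞 F) 𝒜)
    (y : AlgPoints (S.M.obj Kc) Ω) (𝔞 : Ideal (𝓞 F))
    (P : (fibreAt S Kc e 𝒜 y).Points Ω) : Prop :=
  ∀ a ∈ 𝔞, (AlgPoints.map (actAt S Kc e 𝒜 ρ a y).hom.hom.hom P : (fibreAt S Kc e 𝒜 y).Points Ω) = 1

set_option maxHeartbeats 400000 in
/-- (E-ii-4) **THE ISOGENY ROOF `A_{ℓ_e y} —q→ B ←c— A_{ℓ_e y″}` ON THE E-SIDE** — Defs `RoofΩ` ((r1)–(r5), J12 unit pin included) read on the E-tuple over `X` at the sheet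
points `ℓ_e y`, `ℓ_e y″` (substitution of the module docstring).  NOT asserted by declaring it.
[cite: MumfordAV1970, §23 Thm. 2 p. 231; §15 Thm. 1 p. 143] [cite: RapoportSmithlingZhang2020Diagonal, §4.1 p. 17, §4.3 (4.23) p. 21] [cite: Kottwitz1992, §5, p. 391] -/
def RoofAt {F : Type} [Field F] [NumberField F] [IsCMField F] {ι₁ : F →+* ℂ} {Jstar : Matrix (Fin 2) (Fin 2) F}
    {K₀ : C5.OpenCompactSubgroup ↥(finAdelic ↥(maximalRealSubfield F) F (IsCMField.complexConj F) 2 Jstar)}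
    (S : RecordSystemGS F Jstar ι₁ K₀) {Fi : Type} [Field Fi] [Algebra F Fi] (Kc : C5.SmallLevel K₀)
    {Ω : Type} [Field Ω] [Algebra F Ω] (e : Fi →ₐ[F] Ω)
    (𝒜 : Literature.AlgebraicGeometry.AbelianSchemes.AbelianSchemeOver ((Literature.AlgebraicGeometry.Motives.baseChange F Fi).obj (S.M.obj Kc)).left)
    (ρ : Literature.AlgebraicGeometry.AbelianSchemes.AbelianSchemeOver.RingAction (𝓞 F) 𝒜)
    (D : 𝒜.DualPair) (pol : 𝒜.Polarization D) {g N : ℕ} (lvl : 𝒜.LevelStructure g N) (pChar : ℕ) (𝔞 : Ideal (𝓞 F))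
    (y y'' : AlgPoints (S.M.obj Kc) Ω)
    (K : Subgroup ((fibreAt S Kc e 𝒜 y).Points Ω)) : Prop :=
  ∃ (B : Literature.AlgebraicGeometry.AbelianSchemes.AbelianSchemeOver (AlgebraicGeometry.Spec (CommRingCat.of Ω)))
    (DB : B.DualPair) (lamB : B.X ⟶ DB.hat.X) (_ : IsMonHom lamB)
    -- J12 INTERFACE PIN (ref1 (g2) e-12): `B̂`'s Poincaré sheaf is normalised along `A × {ε_B̂}` — the unit clause `hD_B` (for a ★ `Polarization` it is ★ `Polarization.nonempty_unitHatSlice_iso`)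
    (_ : Nonempty ((AlgebraicGeometry.Scheme.Modules.pullback DB.unitHatSlice).obj DB.P ≅ SheafOfModules.unit _))
    (q : (schAt S Kc e 𝒜 y).X ⟶ B.X) (_ : IsMonHom q)
    (c : (schAt S Kc e 𝒜 y'').X ⟶ B.X) (_ : IsMonHom c),
    -- (r1) kernel of `q` on `Ω`-points
    (∀ P : (fibreAt S Kc e 𝒜 y).Points Ω,
        (AlgPoints.map q P : B.toAffine.toAbelianVariety.Points Ω) = 1 ↔ P ∈ K) ∧
    -- (r2) kernel of `c` on `Ω`-points = the `𝔞`-torsion; `c` surjective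
    (∀ P : (fibreAt S Kc e 𝒜 y'').Points Ω,
        (AlgPoints.map c P : B.toAffine.toAbelianVariety.Points Ω) = 1 ↔
          IsIdealTorsionAt S Kc e 𝒜 ρ y'' 𝔞 P) ∧
    Function.Surjective c.left.base ∧
    -- (r3) polarisations: `q^* λ_B = p • λ_y`, `c^* λ_B = p • λ_y″`
    q ≫ lamB ≫ Literature.AlgebraicGeometry.AbelianSchemes.AbelianSchemeOver.DualPair.dualIsogenyOver q (dualAt S Kc e 𝒜 D y) DB =
      (polAt S Kc e 𝒜 pol y).lam ≫ (dualAt S Kc e 𝒜 D y).hat.mulN pChar ∧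
    c ≫ lamB ≫ Literature.AlgebraicGeometry.AbelianSchemes.AbelianSchemeOver.DualPair.dualIsogenyOver c (dualAt S Kc e 𝒜 D y'') DB =
      (polAt S Kc e 𝒜 pol y'').lam ≫ (dualAt S Kc e 𝒜 D y'').hat.mulN pChar ∧
    -- (r4) `𝒪_F`-equivariance through a common endomorphism of `B`
    (∀ a : 𝓞 F, ∃ b : B.X ⟶ B.X,
        (actAt S Kc e 𝒜 ρ a y).hom.hom.hom ≫ q = q ≫ b ∧ (actAt S Kc e 𝒜 ρ a y'').hom.hom.hom ≫ c = c ≫ b) ∧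
    -- (r5) level-`N` points correspond
    (∀ a : Fin g ⊕ Fin g → ZMod N,
        (AlgPoints.map q (lvlPtAt S Kc e 𝒜 lvl y a) : B.toAffine.toAbelianVariety.Points Ω) =
          AlgPoints.map c (lvlPtAt S Kc e 𝒜 lvl y'' a))

/-- **`HeckeRoofsAt … e′ N′ hN′Kc rc₁ hrcN₁ rc₂ hrcN₂ x′` — THE HECKE ROOFS OF A TUPLE OVER `X` READ AT ONE DATUM `(e′, N′, rc₁, rc₂, x′)` OVER ANY `F`-FIELD `Ω`**: the BODY of
E-READINGS `HeckeRoofsE` (ED. 3 :221) TOKEN FOR TOKEN with `F̄_w ↦ Ω` and its `∀`-binders turned into arguments (the two unused representative laws `_hrc₁`∕`_hrc₂`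
dropped), so that `HeckeRoofsE S … p f ↔ ∀ e′ N′ hN′Kc rc₁ _ hrcN₁ rc₂ _ hrcN₂ x′, HeckeRoofsAt S … p f e′ N′ hN′Kc rc₁ hrcN₁ rc₂ hrcN₂ x′` holds by unfolding
(`heckeRoofsE_iff_forall_heckeRoofsAt`, §1) and the SAME reading can be stated at COMPLEX points (`Ω := ℂ`, `e′ := τE`).  NOT asserted by declaring it. [cite: HarrisTaylorAMS2001, §III.4, pp. 108–110]
[cite: RapoportSmithlingZhang2020Diagonal, §4.1 p. 17, §4.3 (4.23) p. 21] [cite: Liu2021, Lemma C.18 p. 115, Prop. D.8 p. 135] -/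
def HeckeRoofsAt {F : Type} [Field F] [NumberField F] [IsCMField F] {ι₁ : F →+* ℂ} {Jstar : Matrix (Fin 2) (Fin 2) F}
    {K₀ : C5.OpenCompactSubgroup ↥(finAdelic ↥(maximalRealSubfield F) F (IsCMField.complexConj F) 2 Jstar)}
    (S : RecordSystemGS F Jstar ι₁ K₀) (hU7ₛ : S.HeckeTranslateDefinedOver)
    (hJ : (Jstar.map (IsCMField.complexConj F))ᵀ = Jstar) (hJu : IsUnit Jstar)
    {Fi : Type} [Field Fi] [Algebra F Fi] (Kc : C5.SmallLevel K₀)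
    (w : HeightOneSpectrum (𝓞 F)) (hw : (IsCMField.complexConj F) • w ≠ w)
    (univ : Literature.AlgebraicGeometry.AbelianSchemes.AbelianSchemeOver ((Literature.AlgebraicGeometry.Motives.baseChange F Fi).obj (S.M.obj Kc)).left)
    (act : Literature.AlgebraicGeometry.AbelianSchemes.AbelianSchemeOver.RingAction (𝓞 F) univ)
    (dual : univ.DualPair) (pol : univ.Polarization dual) {g N : ℕ} (lvl : univ.LevelStructure g N) (pChar fDeg : ℕ)
    {Ω : Type} [Field Ω] [Algebra F Ω] (e' : Fi →ₐ[F] Ω) (N' : C5.SmallLevel K₀) (hN'Kc : N' ≤ Kc)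
    (rc₁ : orbit (Kc.1.1 : Subgroup ↥(finAdelic ↥(maximalRealSubfield F) F (IsCMField.complexConj F) 2 Jstar))
         ((UnitaryGroup.heckeElementAt ↥(maximalRealSubfield F) F (IsCMField.complexConj F) 2 Jstar
             (⟨w, rfl⟩ : UnitaryGroup.PlacesOver F (w.under (𝓞 ↥(maximalRealSubfield F))))
             (IsCMField.complexConj_ne_one F) hJ hw (UnitaryGroup.isUnit_placeForm Jstar hJu w) (HeckeCharacter.uniformizer F w) 1 :
           ↥(finAdelic ↥(maximalRealSubfield F) F (IsCMField.complexConj F) 2 Jstar)) :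
           ↥(finAdelic ↥(maximalRealSubfield F) F (IsCMField.complexConj F) 2 Jstar) ⧸
             (Kc.1.1 : Subgroup ↥(finAdelic ↥(maximalRealSubfield F) F (IsCMField.complexConj F) 2 Jstar))) →
       ↥(finAdelic ↥(maximalRealSubfield F) F (IsCMField.complexConj F) 2 Jstar))
    (hrcN₁ : ∀ β, C5.HeckeLE (rc₁ β) N' Kc)
    (rc₂ : orbit (Kc.1.1 : Subgroup ↥(finAdelic ↥(maximalRealSubfield F) F (IsCMField.complexConj F) 2 Jstar))
         ((UnitaryGroup.heckeElementAt ↥(maximalRealSubfield F) F (IsCMField.complexConj F) 2 Jstar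
             (⟨w, rfl⟩ : UnitaryGroup.PlacesOver F (w.under (𝓞 ↥(maximalRealSubfield F))))
             (IsCMField.complexConj_ne_one F) hJ hw (UnitaryGroup.isUnit_placeForm Jstar hJu w) (HeckeCharacter.uniformizer F w) 2 :
           ↥(finAdelic ↥(maximalRealSubfield F) F (IsCMField.complexConj F) 2 Jstar)) :
           ↥(finAdelic ↥(maximalRealSubfield F) F (IsCMField.complexConj F) 2 Jstar) ⧸
             (Kc.1.1 : Subgroup ↥(finAdelic ↥(maximalRealSubfield F) F (IsCMField.complexConj F) 2 Jstar))) →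
       ↥(finAdelic ↥(maximalRealSubfield F) F (IsCMField.complexConj F) 2 Jstar))
    (hrcN₂ : ∀ β, C5.HeckeLE (rc₂ β) N' Kc)
    (x' : AlgPoints (S.M.obj N') Ω) : Prop :=
    ∃ Hβ : (orbit (Kc.1.1 : Subgroup ↥(finAdelic ↥(maximalRealSubfield F) F (IsCMField.complexConj F) 2 Jstar))
         ((UnitaryGroup.heckeElementAt ↥(maximalRealSubfield F) F (IsCMField.complexConj F) 2 Jstar
             (⟨w, rfl⟩ : UnitaryGroup.PlacesOver F (w.under (𝓞 ↥(maximalRealSubfield F))))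
             (IsCMField.complexConj_ne_one F) hJ hw (UnitaryGroup.isUnit_placeForm Jstar hJu w) (HeckeCharacter.uniformizer F w) 1 :
           ↥(finAdelic ↥(maximalRealSubfield F) F (IsCMField.complexConj F) 2 Jstar)) :
           ↥(finAdelic ↥(maximalRealSubfield F) F (IsCMField.complexConj F) 2 Jstar) ⧸
             (Kc.1.1 : Subgroup ↥(finAdelic ↥(maximalRealSubfield F) F (IsCMField.complexConj F) 2 Jstar)))) →
        Subgroup ((fibreAt S Kc e' univ (AlgPoints.map (S.M.map (homOfLE hN'Kc)) x')).Points Ω),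
      -- the lines: `H_β` runs BIJECTIVELY through the `𝒪_F`-stable order-`q` subgroups of `A_y[𝔭_{c•w}](Ω)`
      Function.Injective Hβ ∧
      (∀ β, Nat.card ↥(Hβ β) = pChar ^ fDeg ∧ (∀ P ∈ Hβ β, IsIdealTorsionAt S Kc e' univ act (AlgPoints.map (S.M.map (homOfLE hN'Kc)) x')
          ((IsCMField.complexConj F) • w).asIdeal P) ∧
        ∀ (a : 𝓞 F), ∀ P ∈ Hβ β, (AlgPoints.map (actAt S Kc e' univ act a (AlgPoints.map (S.M.map (homOfLE hN'Kc)) x')).hom.hom.hom P :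
          (fibreAt S Kc e' univ (AlgPoints.map (S.M.map (homOfLE hN'Kc)) x')).Points Ω) ∈ Hβ β) ∧
      (∀ H : Subgroup ((fibreAt S Kc e' univ (AlgPoints.map (S.M.map (homOfLE hN'Kc)) x')).Points Ω),
        Nat.card ↥H = pChar ^ fDeg → (∀ P ∈ H, IsIdealTorsionAt S Kc e' univ act (AlgPoints.map (S.M.map (homOfLE hN'Kc)) x')
          ((IsCMField.complexConj F) • w).asIdeal P) →
        (∀ (a : 𝓞 F), ∀ P ∈ H, (AlgPoints.map (actAt S Kc e' univ act a (AlgPoints.map (S.M.map (homOfLE hN'Kc)) x')).hom.hom.hom P :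
          (fibreAt S Kc e' univ (AlgPoints.map (S.M.map (homOfLE hN'Kc)) x')).Points Ω) ∈ H) → ∃ β, Hβ β = H) ∧
      -- the `t₁`-translates are the roof neighbours through kernels meeting the `𝔭_{c•w}`-torsion in `H_β`
      (∀ β, ∃ Kβ : Subgroup ((fibreAt S Kc e' univ (AlgPoints.map (S.M.map (homOfLE hN'Kc)) x')).Points Ω),
        (∀ P, P ∈ Hβ β ↔ P ∈ Kβ ∧ IsIdealTorsionAt S Kc e' univ act (AlgPoints.map (S.M.map (homOfLE hN'Kc)) x')
            ((IsCMField.complexConj F) • w).asIdeal P) ∧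
        RoofAt S Kc e' univ act dual pol lvl pChar w.asIdeal (AlgPoints.map (S.M.map (homOfLE hN'Kc)) x')
          (AlgPoints.map (recordHeckeTranslateGS S hU7ₛ (rc₁ β) N' Kc (hrcN₁ β)) x') Kβ) ∧
      -- the `t₂`-translate is the roof neighbour through the whole `𝔭_{c•w}`-torsion (the central translate `⟨ϖ⟩`)
      (∀ β₂, ∃ K₂ : Subgroup ((fibreAt S Kc e' univ (AlgPoints.map (S.M.map (homOfLE hN'Kc)) x')).Points Ω),
        (∀ P, P ∈ K₂ ↔ IsIdealTorsionAt S Kc e' univ act (AlgPoints.map (S.M.map (homOfLE hN'Kc)) x')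
            ((IsCMField.complexConj F) • w).asIdeal P) ∧
        RoofAt S Kc e' univ act dual pol lvl pChar w.asIdeal (AlgPoints.map (S.M.map (homOfLE hN'Kc)) x')
          (AlgPoints.map (recordHeckeTranslateGS S hU7ₛ (rc₂ β₂) N' Kc (hrcN₂ β₂)) x') K₂)

end Summit.HodgeConjecture.HodgeConjecture.Cruxes.HLiu418.F0P6aStubEHECKE
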